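import Mathlib
import Literature.Analysis.FluidPDE.AxisDistancePowerIntegral
import Literature.Analysis.FluidPDE.CylindricalIntegration
import Literature.Analysis.Calculus.PlanarPolarIntegral
import HarnessLib

/-!
# Crux E `PowerGaugeEulerLiouville` (stmt-NavierStokesRegularity-19832), THE ONE STATEMENT `stub_selfSimilarC2Needle`, target T1:
# «THE AXISYMMETRIC NEEDLE HAS NO SWIRL» — kernel tools (1/3): line-family capacity, Tonelli over planes and cylinders
# (width seat ns-ezl-w3 g4; sequel of g3's swirl ratchet `SwirlRatchet.*` and (S37) `NeedleRace.selfSimilar_ae_eq_zero_of_axisymNoSwirlC2`)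

Route №10 `EulerZoomLiouville` (NavierStokesRegularity), crux E; LEAD ns-typeII-p2 g12.  KERNEL TOOLS ONLY (no Euler content):

* `ennreal_le_am_gm` — `x ≤ ε/2 + x²/(2ε)` in `ℝ≥0∞`;
* `norm_sub_le_integral_norm_fderiv_line` — along an affine line `x ↦ p + x•v`, `‖v‖ ≤ 1`, a `C¹` map moves by at most `∫ ‖D·‖`;
  `ofReal_intervalIntegral_le_lintegral` — the real interval integral of a continuous `φ ≥ 0` under the `∫⁻` over a bigger set;
* **`sq_mul_mul_le_of_lineFamily`** — THE LINE-FAMILY CAPACITY BOUND: if a value `u > 0` is carried by every member of a family of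
  lines `σ ∈ S` in the sense `u ≤ f σ τ + ∫⁻_{ξ∈J} g σ ξ` for all end-points `τ ∈ T` (`f` = size of the field at the end-point, `g` = size of
  the gradient along the line), then `u² · |S| · |T| ≤ 2 (A + |T| |J| E)` with `A ≥ ∫⁻_S ∫⁻_T f²`, `E ≥ ∫⁻_S ∫⁻_J g²` (integrate, AM–GM twice);
* `lintegral_eq_lintegral_cartesian` — `∫⁻ G = ∫⁻_z ∫⁻_t ∫⁻_s G(s,t,z)` on `EuclideanSpace ℝ (Fin 3)` (through `Literature…cylSplit` and
  `Literature…measurePreserving_toLp_fin_two`); `lintegral_eq_lintegral_cylindrical_radial` — `∫⁻ G = ∫⁻_{ρ>0} ρ ∫⁻_{θ∈(−π,π)} ∫⁻_z G(ρ cos θ, ρ sin θ, z)`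
  (the radius OUTERMOST; from `Literature…lintegral_eq_lintegral_cylindrical` by two Tonelli swaps).

WHAT THIS IS NOT: not NS regularity, not the crux E — tools for a portrait stratum of the crux CLASS 19832 (MODEL lattice; E/NS strata),
`--supports` stmt-19832; 19832 OPEN. [folklore: FTC, AM–GM, Tonelli; cite: EvansGariepy2015, §3.4.4 (polar coordinates, with Fubini §1.4)]
-/

noncomputable section

-- flat `Theorems/<Route><Decl>…` files of one crux share the namespace of the crux (tree convention: `Summit.<S>.<S>.…`)
set_option linter.dupNamespace false

open MeasureTheory Set Filter Topology Metric Function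
open scoped RealInnerProductSpace NNReal ENNReal

namespace Summit.NavierStokesRegularity.NavierStokesRegularity.Theorems.PowerGaugeEulerLiouville

namespace SwirlBudget

open Literature.Analysis Literature.Analysis.FluidPDE

/-! ### AM–GM in `ℝ≥0∞` -/

/-- `x ≤ ε/2 + x²/(2ε)` for `x ∈ [0, ∞]` and `ε > 0` (`(x − ε)² ≥ 0`). [folklore] -/
theorem ennreal_le_am_gm (x : ℝ≥0∞) {ε : ℝ} (hε : 0 < ε) :
    x ≤ ENNReal.ofReal (ε / 2) + ENNReal.ofReal (1 / (2 * ε)) * x ^ 2 := by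
  rcases eq_or_ne x ⊤ with hx | hx
  · rw [hx, ENNReal.top_pow two_ne_zero, ENNReal.mul_top (by positivity)]
    simp
  · set r : ℝ := x.toReal with hr
    have hr0 : 0 ≤ r := ENNReal.toReal_nonneg
    have hxr : x = ENNReal.ofReal r := (ENNReal.ofReal_toReal hx).symm
    rw [hxr, ← ENNReal.ofReal_pow hr0, ← ENNReal.ofReal_mul (by positivity), ← ENNReal.ofReal_add (by positivity)
      (by positivity)]
    apply ENNReal.ofReal_le_ofReal
    have h1 : 1 / (2 * ε) * r ^ 2 = r ^ 2 / (2 * ε) := by ring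
    rw [h1, ← sub_nonneg]
    have h2 : ε / 2 + r ^ 2 / (2 * ε) - r = (r - ε) ^ 2 / (2 * ε) := by field_simp; ring
    rw [h2]
    positivity

/-! ### Motion along affine lines -/

/-- **Motion along a line is bounded by the integral of the gradient**: for `U ∈ C¹(E, F)`, `‖v‖ ≤ 1` and `a ≤ b`,
`‖U(p + b v) − U(p + a v)‖ ≤ ∫_a^b ‖DU(p + x v)‖ dx`. [folklore] -/
theorem norm_sub_le_integral_norm_fderiv_line {E F : Type*} [NormedAddCommGroup E] [NormedSpace ℝ E]
    [NormedAddCommGroup F] [NormedSpace ℝ F] [CompleteSpace F]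
    {U : E → F} (hU : ContDiff ℝ 1 U) (p v : E) (hv : ‖v‖ ≤ 1) {a b : ℝ} (hab : a ≤ b) :
    ‖U (p + b • v) - U (p + a • v)‖ ≤ ∫ x in a..b, ‖fderiv ℝ U (p + x • v)‖ := by
  -- adapted from `…CondenserLengthArea.norm_sub_le_integral_norm_fderiv_ray`
  have hUd : Differentiable ℝ U := hU.differentiable one_ne_zero
  -- the line has velocity `v` (cf. `Literature.Geometry.Symplectic.SphereCR.hasDerivAt_const_add_smul`)
  have hasDerivAt_line : ∀ (p v : E) (x : ℝ), HasDerivAt (fun s : ℝ => p + s • v) v x := fun p v x => by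
    have h := ((hasDerivAt_id x).smul_const v).const_add p
    simpa using h
  have hline : Continuous fun s : ℝ => p + s • v :=
    continuous_iff_continuousAt.2 fun s => (hasDerivAt_line p v s).continuousAt
  have hderiv : ∀ s, HasDerivAt (fun s : ℝ => U (p + s • v)) (fderiv ℝ U (p + s • v) v) s :=
    fun s => (hUd _).hasFDerivAt.comp_hasDerivAt s (hasDerivAt_line p v s)
  have hcontD : Continuous fun s : ℝ => fderiv ℝ U (p + s • v) v :=
    ((hU.continuous_fderiv one_ne_zero).comp hline).clm_apply continuous_const
  have hftc := intervalIntegral.integral_eq_sub_of_hasDerivAt (fun s _ => hderiv s)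
    (hcontD.intervalIntegrable a b)
  rw [← hftc]
  refine (intervalIntegral.norm_integral_le_integral_norm hab).trans ?_
  refine intervalIntegral.integral_mono_on hab (hcontD.norm.intervalIntegrable a b)
    (((hU.continuous_fderiv one_ne_zero).comp hline).norm.intervalIntegrable a b) fun s _ => ?_
  exact (ContinuousLinearMap.le_opNorm _ _).trans (mul_le_of_le_one_right (norm_nonneg _) hv)

/-- The interval integral of a continuous `φ ≥ 0` over `[a, b]` is at most its lower Lebesgue integral over any
measurable `J ⊇ [a, b]`. [folklore] -/
theorem ofReal_intervalIntegral_le_lintegral {φ : ℝ → ℝ} (hφ : Continuous φ) (h0 : ∀ x, 0 ≤ φ x)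
    {a b : ℝ} (hab : a ≤ b) {J : Set ℝ} (hJ : Icc a b ⊆ J) :
    ENNReal.ofReal (∫ x in a..b, φ x) ≤ ∫⁻ x in J, ENNReal.ofReal (φ x) := by
  rw [intervalIntegral.integral_of_le hab,
    ofReal_integral_eq_lintegral_ofReal (hφ.integrableOn_Icc.mono_set Ioc_subset_Icc_self)
      (ae_of_all _ fun x => h0 x)]
  exact lintegral_mono_set (Ioc_subset_Icc_self.trans hJ)

/-! ### The line-family capacity bound -/

/-- **THE LINE-FAMILY CAPACITY BOUND.**  `S, T ⊆ ℝ` measurable, `J ⊆ ℝ`, of lengths `|S| = mS ≥ 0`, `|T| = mT > 0`, `|J| = mJ > 0`; `f, g ≥ 0`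
jointly measurable; a number `u > 0` with `u ≤ f σ τ + ∫⁻_{ξ ∈ J} g σ ξ` for all `σ ∈ S`, `τ ∈ T` (think: `u` = the size of a `C¹` field on a
curve met by every line `σ` of the family, `f σ τ` = its size at the end-point `τ` of the line, `g σ ·` = the size of its gradient along the
line); and square budgets `∫⁻_S ∫⁻_T f² ≤ A`, `∫⁻_S ∫⁻_J g² ≤ E`.  Then `u² · mS · mT ≤ 2 (A + mT · mJ · E)`.
(Integrate the pointwise bound over `S × T`, then AM–GM `f ≤ ε/2 + f²/(2ε)`, `g ≤ ε′/2 + g²/(2ε′)` with `ε = u/2`, `ε′ = u/(2 mJ)`.) [folklore] -/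
theorem sq_mul_mul_le_of_lineFamily {S T J : Set ℝ} (hS : MeasurableSet S) (hT : MeasurableSet T)
    {mS mT mJ : ℝ} (hmS : volume S = ENNReal.ofReal mS) (hmT : volume T = ENNReal.ofReal mT)
    (hmJ : volume J = ENNReal.ofReal mJ) (hmS0 : 0 ≤ mS) (hmT0 : 0 < mT) (hmJ0 : 0 < mJ)
    {u : ℝ} (hu : 0 < u) {f g : ℝ → ℝ → ℝ≥0∞} (hf : Measurable (uncurry f)) (hg : Measurable (uncurry g))
    (hpt : ∀ σ ∈ S, ∀ τ ∈ T, ENNReal.ofReal u ≤ f σ τ + ∫⁻ ξ in J, g σ ξ)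
    {A E : ℝ} (hA0 : 0 ≤ A) (hE0 : 0 ≤ E)
    (hA : ∫⁻ σ in S, ∫⁻ τ in T, f σ τ ^ 2 ≤ ENNReal.ofReal A)
    (hE : ∫⁻ σ in S, ∫⁻ ξ in J, g σ ξ ^ 2 ≤ ENNReal.ofReal E) :
    u ^ 2 * mS * mT ≤ 2 * (A + mT * mJ * E) := by
  -- measurability of the sections and of the partial integrals
  have hfσ : ∀ σ, Measurable (f σ) := fun σ => hf.comp measurable_prodMk_left
  have hgσ : ∀ σ, Measurable (g σ) := fun σ => hg.comp measurable_prodMk_left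
  have hF : Measurable fun σ => ∫⁻ τ in T, f σ τ := hf.lintegral_prod_right
  have hG : Measurable fun σ => ∫⁻ ξ in J, g σ ξ := hg.lintegral_prod_right
  have hF2 : Measurable fun σ => ∫⁻ τ in T, f σ τ ^ 2 := (hf.pow_const 2).lintegral_prod_right
  have hG2 : Measurable fun σ => ∫⁻ ξ in J, g σ ξ ^ 2 := (hg.pow_const 2).lintegral_prod_right
  have hvolT : volume.restrict T univ = ENNReal.ofReal mT := by rw [Measure.restrict_apply_univ, hmT]
  have hvolS : volume.restrict S univ = ENNReal.ofReal mS := by rw [Measure.restrict_apply_univ, hmS]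
  have hvolJ : volume.restrict J univ = ENNReal.ofReal mJ := by rw [Measure.restrict_apply_univ, hmJ]
  -- (1) integrate the pointwise bound over `S × T`
  have h1 : ENNReal.ofReal u * ENNReal.ofReal mT * ENNReal.ofReal mS ≤
      (∫⁻ σ in S, ∫⁻ τ in T, f σ τ) + ENNReal.ofReal mT * ∫⁻ σ in S, ∫⁻ ξ in J, g σ ξ := by
    have hin : ∀ σ ∈ S, ENNReal.ofReal u * ENNReal.ofReal mT ≤
        (∫⁻ τ in T, f σ τ) + ENNReal.ofReal mT * ∫⁻ ξ in J, g σ ξ := by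
      intro σ hσ
      calc ENNReal.ofReal u * ENNReal.ofReal mT = ∫⁻ τ in T, ENNReal.ofReal u := by
            rw [lintegral_const, hvolT]
        _ ≤ ∫⁻ τ in T, (f σ τ + ∫⁻ ξ in J, g σ ξ) := setLIntegral_mono' hT fun τ hτ => hpt σ hσ τ hτ
        _ = (∫⁻ τ in T, f σ τ) + (∫⁻ ξ in J, g σ ξ) * ENNReal.ofReal mT := by
            rw [lintegral_add_right _ measurable_const, lintegral_const, hvolT]
        _ = _ := by rw [mul_comm (∫⁻ ξ in J, g σ ξ)]
    calc ENNReal.ofReal u * ENNReal.ofReal mT * ENNReal.ofReal mS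
        = ∫⁻ σ in S, ENNReal.ofReal u * ENNReal.ofReal mT := by rw [lintegral_const, hvolS]
      _ ≤ ∫⁻ σ in S, ((∫⁻ τ in T, f σ τ) + ENNReal.ofReal mT * ∫⁻ ξ in J, g σ ξ) := setLIntegral_mono' hS hin
      _ = _ := by
          rw [lintegral_add_left hF, lintegral_const_mul' _ _ ENNReal.ofReal_ne_top]
  -- (2) AM–GM for `f` with `ε = u/2`
  have hε : 0 < u / 2 := by positivity
  have h2 : ∫⁻ σ in S, ∫⁻ τ in T, f σ τ ≤
      ENNReal.ofReal (u / 2 / 2 * mT * mS) + ENNReal.ofReal (1 / (2 * (u / 2))) * ENNReal.ofReal A := by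
    calc ∫⁻ σ in S, ∫⁻ τ in T, f σ τ
        ≤ ∫⁻ σ in S, ∫⁻ τ in T, (ENNReal.ofReal (u / 2 / 2) + ENNReal.ofReal (1 / (2 * (u / 2))) * f σ τ ^ 2) :=
          lintegral_mono fun σ => lintegral_mono fun τ => ennreal_le_am_gm _ hε
      _ = ∫⁻ σ in S, (ENNReal.ofReal (u / 2 / 2) * ENNReal.ofReal mT +
            ENNReal.ofReal (1 / (2 * (u / 2))) * ∫⁻ τ in T, f σ τ ^ 2) := by
          refine lintegral_congr fun σ => ?_
          rw [lintegral_add_left measurable_const, lintegral_const, hvolT,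
            lintegral_const_mul' _ _ ENNReal.ofReal_ne_top]
      _ = ENNReal.ofReal (u / 2 / 2) * ENNReal.ofReal mT * ENNReal.ofReal mS +
            ENNReal.ofReal (1 / (2 * (u / 2))) * ∫⁻ σ in S, ∫⁻ τ in T, f σ τ ^ 2 := by
          rw [lintegral_add_left measurable_const, lintegral_const, hvolS,
            lintegral_const_mul' _ _ ENNReal.ofReal_ne_top]
      _ ≤ _ := by
          rw [← ENNReal.ofReal_mul (by positivity), ← ENNReal.ofReal_mul (by positivity)]
          gcongr
  -- (3) AM–GM for `g` with `ε' = u/(2 mJ)`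
  have hε' : 0 < u / (2 * mJ) := by positivity
  have h3 : ∫⁻ σ in S, ∫⁻ ξ in J, g σ ξ ≤
      ENNReal.ofReal (u / (2 * mJ) / 2 * mJ * mS) + ENNReal.ofReal (1 / (2 * (u / (2 * mJ)))) * ENNReal.ofReal E := by
    calc ∫⁻ σ in S, ∫⁻ ξ in J, g σ ξ
        ≤ ∫⁻ σ in S, ∫⁻ ξ in J, (ENNReal.ofReal (u / (2 * mJ) / 2) +
            ENNReal.ofReal (1 / (2 * (u / (2 * mJ)))) * g σ ξ ^ 2) :=
          lintegral_mono fun σ => lintegral_mono fun ξ => ennreal_le_am_gm _ hε'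
      _ = ∫⁻ σ in S, (ENNReal.ofReal (u / (2 * mJ) / 2) * ENNReal.ofReal mJ +
            ENNReal.ofReal (1 / (2 * (u / (2 * mJ)))) * ∫⁻ ξ in J, g σ ξ ^ 2) := by
          refine lintegral_congr fun σ => ?_
          rw [lintegral_add_left measurable_const, lintegral_const, hvolJ,
            lintegral_const_mul' _ _ ENNReal.ofReal_ne_top]
      _ = ENNReal.ofReal (u / (2 * mJ) / 2) * ENNReal.ofReal mJ * ENNReal.ofReal mS +
            ENNReal.ofReal (1 / (2 * (u / (2 * mJ)))) * ∫⁻ σ in S, ∫⁻ ξ in J, g σ ξ ^ 2 := by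
          rw [lintegral_add_left measurable_const, lintegral_const, hvolS,
            lintegral_const_mul' _ _ ENNReal.ofReal_ne_top]
      _ ≤ _ := by
          rw [← ENNReal.ofReal_mul (by positivity), ← ENNReal.ofReal_mul (by positivity)]
          gcongr
  -- (4) assemble in `ℝ`
  have h4 : ENNReal.ofReal (u * mT * mS) ≤
      ENNReal.ofReal ((u / 2 / 2 * mT * mS + 1 / (2 * (u / 2)) * A) +
        mT * (u / (2 * mJ) / 2 * mJ * mS + 1 / (2 * (u / (2 * mJ))) * E)) := by
    have e1 : ENNReal.ofReal (u * mT * mS) = ENNReal.ofReal u * ENNReal.ofReal mT * ENNReal.ofReal mS := by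
      rw [ENNReal.ofReal_mul (by positivity), ENNReal.ofReal_mul hu.le]
    rw [e1]
    refine h1.trans ?_
    rw [ENNReal.ofReal_add (by positivity) (by positivity), ENNReal.ofReal_mul hmT0.le,
      ENNReal.ofReal_add (by positivity) (by positivity), ENNReal.ofReal_add (by positivity) (by positivity),
      ENNReal.ofReal_mul (by positivity : (0:ℝ) ≤ 1 / (2 * (u / 2))),
      ENNReal.ofReal_mul (by positivity : (0:ℝ) ≤ 1 / (2 * (u / (2 * mJ))))]
    gcongr
  rw [ENNReal.ofReal_le_ofReal_iff (by positivity)] at h4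
  -- `u mT mS ≤ u mT mS/4 + A/u + u mT mS/4 + mT mJ E/u`
  have e2 : u / 2 / 2 * mT * mS + 1 / (2 * (u / 2)) * A +
      mT * (u / (2 * mJ) / 2 * mJ * mS + 1 / (2 * (u / (2 * mJ))) * E) =
      u * mT * mS / 2 + (A + mT * mJ * E) / u := by
    field_simp
    ring
  rw [e2] at h4
  have h5 : u * mT * mS / 2 ≤ (A + mT * mJ * E) / u := by linarith
  rw [le_div_iff₀ hu] at h5
  nlinarith


/-! ### Tonelli over coordinate planes and over cylinders about the axis -/

/-- The Cartesian coordinate map `(s, t, z) ↦ (s, t, z) ∈ E³` is continuous (private plumbing). [folklore] -/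
theorem continuous_cartesianPt :
    Continuous fun p : ℝ × ℝ × ℝ => (WithLp.toLp 2 ![p.1, p.2.1, p.2.2] : EuclideanSpace ℝ (Fin 3)) := by
  refine (PiLp.continuous_toLp 2 _).comp (continuous_pi fun i => ?_)
  fin_cases i
  · exact continuous_fst
  · exact continuous_fst.comp continuous_snd
  · exact continuous_snd.comp continuous_snd

/-- The cylindrical coordinate map `(ρ, θ, z) ↦ (ρ cos θ, ρ sin θ, z) ∈ E³` is continuous (private plumbing). [folklore] -/
theorem continuous_cylindricalPt :
    Continuous fun p : ℝ × ℝ × ℝ =>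
      (WithLp.toLp 2 ![p.1 * Real.cos p.2.1, p.1 * Real.sin p.2.1, p.2.2] : EuclideanSpace ℝ (Fin 3)) := by
  refine (PiLp.continuous_toLp 2 _).comp (continuous_pi fun i => ?_)
  fin_cases i
  · exact continuous_fst.mul (Real.continuous_cos.comp (continuous_fst.comp continuous_snd))
  · exact continuous_fst.mul (Real.continuous_sin.comp (continuous_fst.comp continuous_snd))
  · exact continuous_snd.comp continuous_snd

/-- **Tonelli in Cartesian coordinates on `EuclideanSpace ℝ (Fin 3)`** (lower Lebesgue integrals): `∫⁻ G = ∫⁻_z ∫⁻_t ∫⁻_s G(s, t, z)` —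
the height `z = x₂` outermost, then `t = x₁`, then `s = x₀` (through `Literature…cylSplit` and `Literature…measurePreserving_toLp_fin_two`).
[cite: EvansGariepy2015, §1.4 (Fubini–Tonelli)] -/
theorem lintegral_eq_lintegral_cartesian {G : EuclideanSpace ℝ (Fin 3) → ℝ≥0∞} (hG : Measurable G) :
    ∫⁻ x, G x = ∫⁻ z : ℝ, ∫⁻ t : ℝ, ∫⁻ s : ℝ, G (WithLp.toLp 2 ![s, t, z]) := by
  -- adapted from `Literature…lintegral_eq_lintegral_cylindrical`
  have h1 : ∫⁻ x, G x = ∫⁻ p : ℝ × EuclideanSpace ℝ (Fin 2), G (cylSplit.symm p) :=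
    (measurePreserving_cylSplit_symm.lintegral_comp_emb cylSplit.symm.measurableEmbedding G).symm
  have hGm : Measurable fun p : ℝ × EuclideanSpace ℝ (Fin 2) => G (cylSplit.symm p) :=
    hG.comp cylSplit.symm.measurable
  rw [h1, Measure.volume_eq_prod, lintegral_prod _ hGm.aemeasurable]
  refine lintegral_congr fun z => ?_
  have h2 : ∫⁻ w : EuclideanSpace ℝ (Fin 2), G (cylSplit.symm (z, w)) =
      ∫⁻ q : ℝ × ℝ, G (cylSplit.symm (z, WithLp.toLp 2 ![q.1, q.2])) :=
    (Calculus.measurePreserving_toLp_fin_two.lintegral_comp_emb Calculus.measurableEmbedding_toLp_fin_two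
      (fun w => G (cylSplit.symm (z, w)))).symm
  have hm : Measurable fun q : ℝ × ℝ => G (cylSplit.symm (z, WithLp.toLp 2 ![q.1, q.2])) := by
    have e : (fun q : ℝ × ℝ => G (cylSplit.symm (z, WithLp.toLp 2 ![q.1, q.2]))) =
        fun q : ℝ × ℝ => G (WithLp.toLp 2 ![q.1, q.2, z]) := by
      funext q; rw [cylSplit_symm_apply]; rfl
    rw [e]
    exact hG.comp ((continuous_cartesianPt).comp
      (continuous_fst.prodMk (continuous_snd.prodMk continuous_const))).measurable
  rw [h2, Measure.volume_eq_prod, lintegral_prod_symm _ hm.aemeasurable]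
  refine lintegral_congr fun t => lintegral_congr fun s => ?_
  rw [cylSplit_symm_apply]
  rfl

/-- **Tonelli in polar coordinates on `EuclideanSpace ℝ (Fin 2)`, radius outermost**: `∫⁻ F = ∫⁻_{ρ>0} ∫⁻_{θ∈(−π,π)} ρ F(ρ cos θ, ρ sin θ)`.
[cite: EvansGariepy2015, §3.4.4 (polar coordinates)] -/
theorem lintegral_eq_lintegral_planePolar_radial {F : EuclideanSpace ℝ (Fin 2) → ℝ≥0∞} (hF : Measurable F) :
    ∫⁻ w, F w = ∫⁻ ρ in Ioi (0 : ℝ), ∫⁻ θ in Ioo (-Real.pi) Real.pi,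
      ENNReal.ofReal ρ * F (WithLp.toLp 2 ![ρ * Real.cos θ, ρ * Real.sin θ]) := by
  -- adapted from `Literature…lintegral_eq_lintegral_planePolar` (there: `θ` outermost)
  have h1 : ∫⁻ w, F w = ∫⁻ q : ℝ × ℝ, F (WithLp.toLp 2 ![q.1, q.2]) :=
    (Calculus.measurePreserving_toLp_fin_two.lintegral_comp_emb Calculus.measurableEmbedding_toLp_fin_two F).symm
  have h2 := lintegral_comp_polarCoord_symm (fun q : ℝ × ℝ => F (WithLp.toLp 2 ![q.1, q.2]))
  rw [h1, ← h2, Calculus.volume_restrict_polarCoord_target]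
  simp only [polarCoord_symm_apply, smul_eq_mul]
  have hpl : Continuous fun p : ℝ × ℝ =>
      (WithLp.toLp 2 ![p.1 * Real.cos p.2, p.1 * Real.sin p.2] : EuclideanSpace ℝ (Fin 2)) := by
    refine (PiLp.continuous_toLp 2 _).comp (continuous_pi fun i => ?_)
    fin_cases i
    · exact continuous_fst.mul (Real.continuous_cos.comp continuous_snd)
    · exact continuous_fst.mul (Real.continuous_sin.comp continuous_snd)
  have hm : Measurable fun p : ℝ × ℝ =>
      ENNReal.ofReal p.1 * F (WithLp.toLp 2 ![p.1 * Real.cos p.2, p.1 * Real.sin p.2]) :=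
    (ENNReal.measurable_ofReal.comp measurable_fst).mul (hF.comp hpl.measurable)
  rw [lintegral_prod _ hm.aemeasurable]

/-- **Tonelli in cylindrical coordinates on `EuclideanSpace ℝ (Fin 3)`, radius outermost**:
`∫⁻ G = ∫⁻_{ρ>0} ρ · ∫⁻_{θ∈(−π,π)} ∫⁻_z G(ρ cos θ, ρ sin θ, z)` (lower Lebesgue integrals, `G` measurable) — the form in which a good
cylinder `{r = ρ}` is chosen by Chebyshev in the radius. [cite: EvansGariepy2015, §3.4.4 (polar coordinates, with Fubini §1.4)] -/
theorem lintegral_eq_lintegral_cylindrical_radial {G : EuclideanSpace ℝ (Fin 3) → ℝ≥0∞} (hG : Measurable G) :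
    ∫⁻ x, G x = ∫⁻ ρ in Ioi (0 : ℝ), ENNReal.ofReal ρ * ∫⁻ θ in Ioo (-Real.pi) Real.pi, ∫⁻ z : ℝ,
      G (WithLp.toLp 2 ![ρ * Real.cos θ, ρ * Real.sin θ, z]) := by
  have h1 : ∫⁻ x, G x = ∫⁻ p : ℝ × EuclideanSpace ℝ (Fin 2), G (cylSplit.symm p) :=
    (measurePreserving_cylSplit_symm.lintegral_comp_emb cylSplit.symm.measurableEmbedding G).symm
  have hGm : Measurable fun p : ℝ × EuclideanSpace ℝ (Fin 2) => G (cylSplit.symm p) :=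
    hG.comp cylSplit.symm.measurable
  -- `w` outermost, `z` innermost
  rw [h1, Measure.volume_eq_prod, lintegral_prod_symm _ hGm.aemeasurable]
  -- the inner `z`-integral is a measurable function of `w`
  have hW : Measurable fun w : EuclideanSpace ℝ (Fin 2) => ∫⁻ z : ℝ, G (cylSplit.symm (z, w)) := by
    have hsw : Measurable (uncurry fun (w : EuclideanSpace ℝ (Fin 2)) (z : ℝ) => G (cylSplit.symm (z, w))) :=
      hGm.comp (measurable_snd.prodMk measurable_fst)
    exact hsw.lintegral_prod_right
  rw [lintegral_eq_lintegral_planePolar_radial hW]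
  refine lintegral_congr fun ρ => ?_
  -- rewrite the points `cylSplit.symm (z, (ρ cos θ, ρ sin θ)) = (ρ cos θ, ρ sin θ, z)`
  have e : ∀ θ : ℝ, (∫⁻ z : ℝ, G (cylSplit.symm (z, WithLp.toLp 2 ![ρ * Real.cos θ, ρ * Real.sin θ]))) =
      ∫⁻ z : ℝ, G (WithLp.toLp 2 ![ρ * Real.cos θ, ρ * Real.sin θ, z]) :=
    fun θ => lintegral_congr fun z => by rw [cylSplit_symm_apply]; rfl
  simp_rw [e]
  -- pull the Jacobian `ρ` out of the `θ`-integral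
  have hθ : Measurable fun θ : ℝ => ∫⁻ z : ℝ, G (WithLp.toLp 2 ![ρ * Real.cos θ, ρ * Real.sin θ, z]) := by
    have hsw : Measurable (uncurry fun (θ : ℝ) (z : ℝ) =>
        G (WithLp.toLp 2 ![ρ * Real.cos θ, ρ * Real.sin θ, z])) :=
      hG.comp (continuous_cylindricalPt.comp (continuous_const.prodMk continuous_id)).measurable
    exact hsw.lintegral_prod_right
  rw [lintegral_const_mul _ hθ]

end SwirlBudget

end Summit.NavierStokesRegularity.NavierStokesRegularity.Theorems.PowerGaugeEulerLiouville

end
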